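import Literature.Analysis.FluidPDE.NSLerayHopfABCLinearization
import Literature.Analysis.FluidPDE.ClassicalLerayProjection
import HarnessLib

/-!
# Albritton–Brué–Colombo 2022: Theorem 1.2 from an EIGENMODE of the linearised similarity operator
  — the stationary form of the remaining hypothesis (Thm. 1.3 (a) / Cor. 3.2 as printed)

Analysis/FluidPDE proofs-layer file (theorems and two unfolding definitions, no named facts) on
the proof line of the named fact `Literature.Analysis.FluidPDE.albritton_brue_colombo_unit`
(`NSLerayHopfABCScaling.lean`; Albritton–Brué–Colombo, Ann. of Math. 196 (2022) =
arXiv:2112.03116 [ABC], Thm. 1.2, faithful rendering) and of **ns.S20**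
`Literature.Analysis.FluidPDE.albritton_brue_colombo` (`NSLerayHopf.lean`), sequel of
`NSLerayHopfABCLinearization.lean`. That file proves
`albritton_brue_colombo_unit_of_linearizedMode`: a steady `Ū ∈ C_c^∞(ℝ³;ℝ³)`, `div Ū = 0`, and a
bounded classical solution `(W, Q)` of the similarity system (1.9) LINEARISED at `Ū`,
`∂_τW − ½(W + DW·ξ) − ΔW + Ū·∇W + W·∇Ū + ∇Q = 0` on the similarity times `τ < τ₁` (i.e.
`∂_τ W = L_ss W`, (1.10)), with `W(τ₀) ≢ 0`, give Thm. 1.2 (by the symmetric split `Ū ± ½W`).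

This file discharges the TIME DEPENDENCE of that hypothesis, bringing it to the exact shape in
which [ABC] Thm. 1.3 (a) (with Cor. 3.2 / Thm. 3.1 and §2) delivers it: an **eigenmode**. If
`λ = a + ib` (`a = Re λ ≥ 0`) and `η = η₁ + iη₂`, `q = q₁ + iq₂` solve the stationary system

  `λη − ½(η + Dη·ξ) − Δη + Ū·∇η + η·∇Ū + ∇q = 0`,  `div η = 0`        (E)

classically on `ℝ³` — (E) is `L_ss η = λη` ((1.10): `−L_ss U = −½(1 + ξ·∇)U − ΔU + P(Ū·∇U + U·∇Ū)`)
written with the pressure `∇q = −(1 − P)(Ū·∇η + η·∇Ū)` instead of the Leray projector `P` — then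
`U^{lin}(τ) := Re(e^{λτ}η) = e^{aτ}(cos(bτ)η₁ − sin(bτ)η₂)` (`AlbrittonBrueColombo2022.reMode`;
[ABC] Thm. 1.3 (a): "`U^{lin}(·,τ) = Re(e^{τλ}η)` is a solution of the linearized equation
`∂_τU^{lin} = L_ss U^{lin}` in `ℝ³ × ℝ`") and `Q(τ) := Re(e^{λτ}q)` form a classical solution of
the linearised system on every time set (`linearizedResidual_reMode`), bounded on `τ < 0`
precisely because `a ≥ 0` (`e^{aτ} ≤ 1`), and `U^{lin}(τ₀) = e^{aτ₀}η₁ ≢ 0` at the times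
`bτ₀ ∈ 2πℤ`. Hence

* **`albritton_brue_colombo_unit_of_unstableMode`**: `Ū ∈ C_c^∞(ℝ³;ℝ³)` divergence free;
  `a ≥ 0`, `b ∈ ℝ`; smooth divergence-free `η₁, η₂`, bounded and in `L² ∩ Ḣ¹`, smooth
  `q₁, q₂ ∈ L²`, solving the real form of (E)
  (`aη₁ − bη₂ + N(η₁) + ∇q₁ = 0`, `bη₁ + aη₂ + N(η₂) + ∇q₂ = 0`,
  `N(η) := −½(η + Dη·ξ) − Δη + Ū·∇η + η·∇Ū = steadyLinearizedResidual Ū η`), and `η₁ ≢ 0`,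
  give `albritton_brue_colombo_unit` (two strict Leray–Hopf solutions on `ℝ³ × [0,T)` from
  `u₀ = 0` with one jointly measurable force in `L¹(0,T;L²)`, distinct at a positive time);
  `albritton_brue_colombo_of_unstableMode` gives ns.S20 at every viscosity;
* **`albritton_brue_colombo_unit_of_unstableMode'`**: the same for ANY smooth divergence-free
  steady background `Ū ∈ L² ∩ Ḣ¹ ∩ L³` with `F̄ = steadyForceProfile Ū ∈ L²` (not necessarily
  compactly supported — e.g. Gaussian vortex rings), via
  `albritton_brue_colombo_unit_of_linearizedSolution`;
* **`albritton_brue_colombo_unit_of_realUnstableMode`**: the case of a real eigenvalue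
  `λ = a ≥ 0` (one profile `η`, one pressure `q`);
* **`albritton_brue_colombo_unit_of_eigenmode`** (and `_of_realEigenmode`,
  `albritton_brue_colombo_of_eigenmode`) — **the operator (1.10) verbatim, no pressure in the
  hypotheses**: with `AlbrittonBrueColombo2022.negLss Ū η := −½(η + Dη·ξ) − Δη + P(Ū·∇η + η·∇Ū)`,
  `P = classicalLerayProj` the classical Leray projection `P[G] = G − ∇Δ⁻¹div G` of the
  compactly supported smooth field `G = B(Ū, η) = Ū·∇η + η·∇Ū` (`ClassicalLerayProjection.lean`:
  Poisson equation and dipole decay of the Newtonian potential of a divergence, so that the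
  pressure `q = −Δ⁻¹div B(Ū, η)` is smooth and in `L²`), the hypotheses are literally
  `L_ss η = λη` in real and imaginary parts, `a = Re λ ≥ 0`, `η₁, η₂` smooth bounded
  divergence free in `L² ∩ Ḣ¹`, `Re η ≢ 0`.

[ABC] Thm. 1.3 (a) provides such data for `Ū` the truncated, divergence-corrected Vishik vortex
ring: "the linearized operator `L_ss` … has a non-trivial unstable eigenvalue `λ`. The
corresponding non-trivial eigenfunction `η` belongs to `H^k` for all `k ≥ 0`" — so `η` is smooth,
bounded and in `L² ∩ Ḣ¹` (Sobolev), `a = Re λ > 0`, `η ∈ L²_σ` is divergence free, and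
`q = −Δ⁻¹ div div(Ū ⊗ η + η ⊗ Ū)` is smooth with `q ∈ L²` (`Ū ∈ C_c^∞`, Riesz transforms);
replacing `η` by `iη` if necessary makes `Re η ≢ 0`; the pressure is supplied by
`albritton_brue_colombo_unit_of_eigenmode` itself. So after this file the distance between the
tree and `albritton_brue_colombo_unit_holds` is EXACTLY the stationary spectral statement
Thm. 1.3 (a) = [Cor. 3.2 ∘ Thm. 3.1 ∘ Prop. 2.6 ∘ Cor. 2.3 ∘ Prop. 2.2 ∘ Thm. 2.1 (Vishik)]
together with the regularity/decay of the eigenfunction — no time variable, no pressure, no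
nonlinear instability (Thm. 1.3 (b) / Thm. 4.1), no unstable-manifold construction. That
statement (spectral theory of a non-self-adjoint operator on `L²_σ(ℝ³)`: essential spectrum
under relatively compact perturbation, Riesz projections, resolvent convergence; Vishik's
unstable vortex) is NOT touched here and no fact is discharged.

## Remarks

* `a ≥ 0` (not only `a > 0`) suffices: a neutral mode `Re λ = 0` of `L_ss` at ANY smooth
  compactly supported divergence-free `Ū` would equally prove Thm. 1.2 (cf. the module docstring
  of `NSLerayHopfABCLinearization.lean`: the force absorbs `R(Ū)`, so `Ū` need not be related to
  an Euler flow). The energy identity still forces `‖(∇Ū)_{sym}‖_∞ ≥ ¼`.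
* The time set is normalised to `τ < 0` (`T = 1` in physical time); `e^{aτ} ≤ 1` there.

## Tree / Mathlib search

Tree: `divPotential`, `classicalLerayProj`, `contDiff_divPotential`,
`lintegral_enorm_sq_divPotential_lt_top`, `classicalLerayProj_apply` (`ClassicalLerayProjection`);
`linearizedResidual`, `similarityResidual`, `similarityResidual_const`,
`albritton_brue_colombo_unit_of_linearizedSolution`, `steadyForceProfile`,
`continuous_steadyForceProfile`, `hasCompactSupport_steadyForceProfile`,
`lintegral_enorm_sq_lt_top_of_hasCompactSupport` (and `_cube_`, `frobeniusNormSq`),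
`lintegral_enorm_add_sq_le`, `lintegral_frobeniusNormSq_add_le`, `frobeniusNormSq_smul`,
`frobeniusNormSq_eq_sum`, `sq_opNorm_le_sum_sq_norm_apply`, `continuous_frobeniusNormSq_fderiv'`,
`divergence_add_apply`, `divergence_const_smul_apply`, `gradient_const_smul`,
`IsSmoothSpaceTimeOn.contDiff_slice`, `albritton_brue_colombo_of_unit`. Mathlib: `HasDerivAt.exp`,
`.cos`, `.sin`, `.mul`, `.smul_const`, `ContDiffAt.laplacian_add`, `laplacian_smul`,
`Continuous.ae_eq_iff_eq`, `Real.cos_periodic.int_mul_eq`, `IsOpen.uniqueDiffWithinAt`.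
`lean search 'reMode|eigenmode|unstableMode|steadyLinearized'`: nothing prior in the ABC files.

## References

* D. Albritton, E. Brué, M. Colombo, *Non-uniqueness of Leray solutions of the forced
  Navier–Stokes equations*, Ann. of Math. 196 (2022) 415–455 = arXiv:2112.03116, §1.1
  (1.9)–(1.10), Thm. 1.2, Thm. 1.3 (a) (`L_ss η = λη`, `a = Re λ > 0`, `U^{lin} = Re(e^{τλ}η)`),
  Thm. 3.1 / Cor. 3.2 (the unstable eigenvalue of `L_ss = L^{(β)}_{vel}`), Thm. 2.1 (Vishik).
  [AlbrittonBrueColombo2022]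
-/

noncomputable section

open MeasureTheory TopologicalSpace Set Function Filter Topology InnerProductSpace Module
open scoped RealInnerProductSpace NNReal ENNReal Laplacian ContDiff

namespace Literature.Analysis.FluidPDE

namespace AlbrittonBrueColombo2022

section General

variable {E : Type*} [NormedAddCommGroup E] [InnerProductSpace ℝ E] [FiniteDimensional ℝ E]

/-! ### The stationary linearised operator `−L_ss` (pressure-free) -/

/-- **The linearisation of the steady part of (1.9) at a steady profile `Ū`**, pressure-free:
`N_Ū(η)(ξ) := −½(η + Dη(ξ)ξ) − Δη + Ū·∇η + η·∇Ū` (Albritton–Brué–Colombo 2022, (1.10):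
`−L_ss U = −½(1 + ξ·∇)U − ΔU + P(Ū·∇U + U·∇Ū)`, so `−L_ss η = N_Ū(η) + ∇q` with
`∇q = −(1 − P)(Ū·∇η + η·∇Ū)`, and the eigenvalue equation `L_ss η = λη` of Thm. 1.3 (a) reads
`λη + N_Ū(η) + ∇q = 0`). It is the linearised residual `linearizedResidual` of constant paths
(`linearizedResidual_const_left`). [cite: AlbrittonBrueColombo2022, §1.1 (1.10) and Thm. 1.3 (a)] -/
def steadyLinearizedResidual (Ubar η : E → E) (ξ : E) : E :=
  -((2⁻¹ : ℝ) • (η ξ + fderiv ℝ η ξ ξ)) - (Δ η) ξ + (convect Ubar η ξ + convect η Ubar ξ)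

/-- Unfolding `steadyLinearizedResidual`. [cite: AlbrittonBrueColombo2022, §1.1 (1.10)] -/
theorem steadyLinearizedResidual_apply (Ubar η : E → E) (ξ : E) :
    steadyLinearizedResidual Ubar η ξ =
      -((2⁻¹ : ℝ) • (η ξ + fderiv ℝ η ξ ξ)) - (Δ η) ξ + (convect Ubar η ξ + convect η Ubar ξ) :=
  rfl

/-- **`Lin_Ū(W) = ∂_τW + N_Ū(W(τ))` for a steady background**: the linearised residual (1.10) of a
profile path `W` at the constant path `Ū` is its time derivative plus the stationary operator
applied to the slice. [cite: AlbrittonBrueColombo2022, §1.1 (1.10)] -/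
theorem linearizedResidual_const_left (S : Set ℝ) (Ubar : E → E) (W : ℝ → E → E) (τ : ℝ)
    (ξ : E) :
    linearizedResidual S (fun _ => Ubar) W τ ξ =
      timeDerivWithin S W τ ξ + steadyLinearizedResidual Ubar (W τ) ξ := by
  rw [linearizedResidual_apply, steadyLinearizedResidual_apply]
  abel

/-- The stationary operator annihilates the zero profile (`D0 = 0`, `Δ0 = 0`). [folklore] -/
theorem steadyLinearizedResidual_zero (Ubar : E → E) (ξ : E) :
    steadyLinearizedResidual Ubar (fun _ => (0 : E)) ξ = 0 := by
  have h0 : (fun _ : E => (0 : E)) = (0 : E → E) := rfl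
  have hD : fderiv ℝ (fun _ : E => (0 : E)) ξ = 0 := by
    rw [h0, fderiv_zero]; rfl
  have hL : (Δ (fun _ : E => (0 : E))) ξ = 0 := by
    have hc : ContDiffAt ℝ 2 (fun _ : E => (0 : E)) ξ := contDiffAt_const
    have h := InnerProductSpace.laplacian_smul (0 : ℝ) hc
    rw [zero_smul, zero_smul] at h
    rw [h0]
    exact h
  simp [steadyLinearizedResidual_apply, convect_apply, hD, hL]

/-- **Linearity of `N_Ū`**: `N_Ū(c₁η₁ + c₂η₂) = c₁N_Ū(η₁) + c₂N_Ū(η₂)` for `C²` profiles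
(linearity of `D`, `Δ` and of `(u, v) ↦ u·∇v` in each slot). [folklore] -/
theorem steadyLinearizedResidual_lincomb (Ubar : E → E) {η₁ η₂ : E → E} (h₁ : ContDiff ℝ 2 η₁)
    (h₂ : ContDiff ℝ 2 η₂) (c₁ c₂ : ℝ) (ξ : E) :
    steadyLinearizedResidual Ubar (fun ζ => c₁ • η₁ ζ + c₂ • η₂ ζ) ξ =
      c₁ • steadyLinearizedResidual Ubar η₁ ξ + c₂ • steadyLinearizedResidual Ubar η₂ ξ := by
  have hd₁ : DifferentiableAt ℝ η₁ ξ := (h₁.differentiable (by norm_num)).differentiableAt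
  have hd₂ : DifferentiableAt ℝ η₂ ξ := (h₂.differentiable (by norm_num)).differentiableAt
  have hc₁ : ContDiffAt ℝ 2 η₁ ξ := h₁.contDiffAt
  have hc₂ : ContDiffAt ℝ 2 η₂ ξ := h₂.contDiffAt
  -- the space derivative
  have hD : ∀ v, fderiv ℝ (fun ζ => c₁ • η₁ ζ + c₂ • η₂ ζ) ξ v =
      c₁ • fderiv ℝ η₁ ξ v + c₂ • fderiv ℝ η₂ ξ v := fun v => by
    rw [fderiv_fun_add (hd₁.fun_const_smul c₁) (hd₂.fun_const_smul c₂),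
      fderiv_fun_const_smul hd₁, fderiv_fun_const_smul hd₂]
    rfl
  -- the Laplacian
  have hL : (Δ (fun ζ => c₁ • η₁ ζ + c₂ • η₂ ζ)) ξ = c₁ • (Δ η₁) ξ + c₂ • (Δ η₂) ξ := by
    have e1 : (fun ζ => c₁ • η₁ ζ + c₂ • η₂ ζ) =
        (fun ζ => c₁ • η₁ ζ) + fun ζ => c₂ • η₂ ζ := rfl
    have e2 : (fun ζ => c₁ • η₁ ζ) = c₁ • η₁ := rfl
    have e3 : (fun ζ => c₂ • η₂ ζ) = c₂ • η₂ := rfl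
    rw [e1, ContDiffAt.laplacian_add (hc₁.const_smul c₁) (hc₂.const_smul c₂), e2, e3,
      laplacian_smul c₁ hc₁, laplacian_smul c₂ hc₂]
  simp only [steadyLinearizedResidual_apply, convect_apply, hD, hL, map_add, map_smul]
  module

omit [FiniteDimensional ℝ E] in
/-- Divergence of a linear combination of divergence-free fields. [folklore] -/
theorem isDivFree_lincomb {η₁ η₂ : E → E} (hd₁ : Differentiable ℝ η₁) (hd₂ : Differentiable ℝ η₂)
    (h₁ : VectorCalculus.IsDivFree η₁) (h₂ : VectorCalculus.IsDivFree η₂) (c₁ c₂ : ℝ) :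
    VectorCalculus.IsDivFree (fun ζ => c₁ • η₁ ζ + c₂ • η₂ ζ) := fun ξ => by
  rw [divergence_add_apply ((hd₁ ξ).fun_const_smul c₁) ((hd₂ ξ).fun_const_smul c₂),
    divergence_const_smul_apply (hd₁ ξ), divergence_const_smul_apply (hd₂ ξ), h₁ ξ, h₂ ξ,
    mul_zero, mul_zero, add_zero]

/-- `∇(p₁ + p₂) = ∇p₁ + ∇p₂` at a point of differentiability. [folklore] -/
theorem gradient_fun_add' {p₁ p₂ : E → ℝ} {ξ : E} (h₁ : DifferentiableAt ℝ p₁ ξ)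
    (h₂ : DifferentiableAt ℝ p₂ ξ) :
    gradient (fun y => p₁ y + p₂ y) ξ = gradient p₁ ξ + gradient p₂ ξ := by
  simp only [gradient, fderiv_fun_add h₁ h₂, map_add]

/-- `∇(c₁q₁ + c₂q₂) = c₁∇q₁ + c₂∇q₂` at a point of differentiability. [folklore] -/
theorem gradient_lincomb {q₁ q₂ : E → ℝ} {ξ : E} (h₁ : DifferentiableAt ℝ q₁ ξ)
    (h₂ : DifferentiableAt ℝ q₂ ξ) (c₁ c₂ : ℝ) :
    gradient (fun ζ => c₁ • q₁ ζ + c₂ • q₂ ζ) ξ = c₁ • gradient q₁ ξ + c₂ • gradient q₂ ξ := by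
  have e1 : (fun ζ => c₁ • q₁ ζ + c₂ • q₂ ζ) =
      fun ζ => (fun y => c₁ • q₁ y) ζ + (fun y => c₂ • q₂ y) ζ := rfl
  rw [e1, gradient_fun_add' (h₁.fun_const_smul c₁) (h₂.fun_const_smul c₂),
    gradient_const_smul h₁, gradient_const_smul h₂]

/-! ### The mode `Re(e^{λτ}η)` -/

variable {X : Type*} {F : Type*} [NormedAddCommGroup F] [NormedSpace ℝ F]

/-- **The real part of a complex exponential mode**: for `λ = a + ib` and `η = η₁ + iη₂`,
`Re(e^{λτ}η) = e^{aτ}(cos(bτ) η₁ − sin(bτ) η₂)` — the function `U^{lin}(·,τ) = Re(e^{τλ}η)` of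
Albritton–Brué–Colombo 2022, Thm. 1.3 (a) (and, with `q` for `η`, its pressure), written with
two real profiles so that no complex structure on the target is needed. [cite: AlbrittonBrueColombo2022, Thm. 1.3 (a)] -/
def reMode (a b : ℝ) (η₁ η₂ : X → F) (τ : ℝ) (x : X) : F :=
  Real.exp (a * τ) • (Real.cos (b * τ) • η₁ x - Real.sin (b * τ) • η₂ x)

/-- Unfolding `reMode`. [folklore] -/
theorem reMode_apply (a b : ℝ) (η₁ η₂ : X → F) (τ : ℝ) (x : X) :
    reMode a b η₁ η₂ τ x =
      Real.exp (a * τ) • (Real.cos (b * τ) • η₁ x - Real.sin (b * τ) • η₂ x) := rfl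

/-- `Re(e^{λτ}η)` as a linear combination of the two real profiles with the coefficients
`e^{aτ}cos(bτ)` and `−e^{aτ}sin(bτ)`. [folklore] -/
theorem reMode_eq (a b : ℝ) (η₁ η₂ : X → F) (τ : ℝ) (x : X) :
    reMode a b η₁ η₂ τ x =
      (Real.exp (a * τ) * Real.cos (b * τ)) • η₁ x +
        (-(Real.exp (a * τ) * Real.sin (b * τ))) • η₂ x := by
  rw [reMode_apply, smul_sub, smul_smul, smul_smul]
  module

/-- The slice of the mode at time `τ` as a linear combination. [folklore] -/
theorem reMode_slice (a b : ℝ) (η₁ η₂ : X → F) (τ : ℝ) :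
    reMode a b η₁ η₂ τ =
      fun x => (Real.exp (a * τ) * Real.cos (b * τ)) • η₁ x +
        (-(Real.exp (a * τ) * Real.sin (b * τ))) • η₂ x :=
  funext fun x => reMode_eq a b η₁ η₂ τ x

/-- **`∂_τ Re(e^{λτ}η) = Re(λ e^{λτ}η)`**: the time derivative of the mode is the mode of the
profiles `(aη₁ − bη₂, bη₁ + aη₂)` (real and imaginary parts of `λη`). [cite: AlbrittonBrueColombo2022, Thm. 1.3 (a)] -/
theorem hasDerivAt_reMode (a b : ℝ) (η₁ η₂ : X → F) (τ : ℝ) (x : X) :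
    HasDerivAt (fun σ => reMode a b η₁ η₂ σ x)
      (reMode a b (fun y => a • η₁ y - b • η₂ y) (fun y => b • η₁ y + a • η₂ y) τ x) τ := by
  have hla : HasDerivAt (fun σ : ℝ => a * σ) a τ := by
    simpa using (hasDerivAt_id τ).const_mul a
  have hlb : HasDerivAt (fun σ : ℝ => b * σ) b τ := by
    simpa using (hasDerivAt_id τ).const_mul b
  have he : HasDerivAt (fun σ => Real.exp (a * σ)) (Real.exp (a * τ) * a) τ := hla.exp
  have hc : HasDerivAt (fun σ => Real.cos (b * σ)) (-Real.sin (b * τ) * b) τ := hlb.cos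
  have hs : HasDerivAt (fun σ => Real.sin (b * σ)) (Real.cos (b * τ) * b) τ := hlb.sin
  have hf := he.mul hc
  have hg := (he.mul hs).neg
  have hW := (hf.smul_const (η₁ x)).add (hg.smul_const (η₂ x))
  have hfun : (fun σ => reMode a b η₁ η₂ σ x) =
      fun σ => (Real.exp (a * σ) * Real.cos (b * σ)) • η₁ x +
        (-(Real.exp (a * σ) * Real.sin (b * σ))) • η₂ x :=
    funext fun σ => reMode_eq a b η₁ η₂ σ x
  rw [hfun]
  refine hW.congr_deriv ?_
  simp only [reMode_apply, smul_sub, smul_add, smul_smul]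
  module

/-- The time derivative of the mode within any time set, at a point of unique differentiability.
[cite: AlbrittonBrueColombo2022, Thm. 1.3 (a)] -/
theorem timeDerivWithin_reMode {S : Set ℝ} {τ : ℝ} (hS : UniqueDiffWithinAt ℝ S τ) (a b : ℝ)
    (η₁ η₂ : X → F) (x : X) :
    timeDerivWithin S (reMode a b η₁ η₂) τ x =
      reMode a b (fun y => a • η₁ y - b • η₂ y) (fun y => b • η₁ y + a • η₂ y) τ x := by
  rw [timeDerivWithin_apply]
  exact (hasDerivAt_reMode a b η₁ η₂ τ x).hasDerivWithinAt.derivWithin hS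

/-- **Joint smoothness of the mode**: for smooth profiles, `(τ, x) ↦ Re(e^{λτ}η)(x)` is jointly
`C^∞` on every time set. [cite: AlbrittonBrueColombo2022, Thm. 1.3 (a)] -/
theorem isSmoothSpaceTimeOn_reMode {X : Type*} [NormedAddCommGroup X] [NormedSpace ℝ X]
    {η₁ η₂ : X → F} (h₁ : ContDiff ℝ ∞ η₁) (h₂ : ContDiff ℝ ∞ η₂) (a b : ℝ) (S : Set ℝ) :
    IsSmoothSpaceTimeOn S (reMode a b η₁ η₂) := by
  change ContDiffOn ℝ ∞ (fun z : ℝ × X => reMode a b η₁ η₂ z.1 z.2) (S ×ˢ univ)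
  have hl : ∀ c : ℝ, ContDiff ℝ ∞ fun z : ℝ × X => c * z.1 := fun c =>
    contDiff_const.mul contDiff_fst
  have he : ContDiff ℝ ∞ fun z : ℝ × X => Real.exp (a * z.1) := Real.contDiff_exp.comp (hl a)
  have hc : ContDiff ℝ ∞ fun z : ℝ × X => Real.cos (b * z.1) := Real.contDiff_cos.comp (hl b)
  have hs : ContDiff ℝ ∞ fun z : ℝ × X => Real.sin (b * z.1) := Real.contDiff_sin.comp (hl b)
  exact (he.smul ((hc.smul (h₁.comp contDiff_snd)).sub (hs.smul (h₂.comp contDiff_snd)))).contDiffOn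

/-- **The mode solves the linearised system iff the profiles solve the eigen-system**, in the
form of an identity: for `W = Re(e^{λτ}η)`, `Q = Re(e^{λτ}q)` and a steady background `Ū`,
`Lin_Ū(W)(τ) + ∇Q(τ) = e^{aτ}cos(bτ)·[aη₁ − bη₂ + N_Ū(η₁) + ∇q₁] − e^{aτ}sin(bτ)·[bη₁ + aη₂ + N_Ū(η₂) + ∇q₂]`
— the real part of `e^{λτ}(λη − L_ss η)` written with pressures (Albritton–Brué–Colombo 2022,
Thm. 1.3 (a): `U^{lin} = Re(e^{τλ}η)` solves `∂_τ U^{lin} = L_ss U^{lin}` when `L_ss η = λη`).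
[cite: AlbrittonBrueColombo2022, Thm. 1.3 (a) and (1.10)] -/
theorem linearizedResidual_reMode {S : Set ℝ} {τ : ℝ} (hS : UniqueDiffWithinAt ℝ S τ)
    (Ubar : E → E) {a b : ℝ} {η₁ η₂ : E → E} {q₁ q₂ : E → ℝ} (h₁ : ContDiff ℝ 2 η₁)
    (h₂ : ContDiff ℝ 2 η₂) (hq₁ : Differentiable ℝ q₁) (hq₂ : Differentiable ℝ q₂) (ξ : E) :
    linearizedResidual S (fun _ => Ubar) (reMode a b η₁ η₂) τ ξ +
        gradient (reMode a b q₁ q₂ τ) ξ =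
      (Real.exp (a * τ) * Real.cos (b * τ)) •
          (a • η₁ ξ - b • η₂ ξ + steadyLinearizedResidual Ubar η₁ ξ + gradient q₁ ξ) +
        (-(Real.exp (a * τ) * Real.sin (b * τ))) •
          (b • η₁ ξ + a • η₂ ξ + steadyLinearizedResidual Ubar η₂ ξ + gradient q₂ ξ) := by
  rw [linearizedResidual_const_left, timeDerivWithin_reMode hS, reMode_slice a b η₁ η₂ τ,
    reMode_slice a b q₁ q₂ τ, steadyLinearizedResidual_lincomb Ubar h₁ h₂, gradient_lincomb (hq₁ ξ)
    (hq₂ ξ)]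
  simp only [reMode_eq]
  module

end General

/-! ### A time with `cos(bτ₀) = 1`, `sin(bτ₀) = 0` below any level -/

/-- Below every `τ₁` there is a time `τ₀` with `bτ₀ ∈ 2πℤ`. [folklore] -/
theorem exists_lt_cos_eq_one_sin_eq_zero (b τ₁ : ℝ) :
    ∃ τ₀ < τ₁, Real.cos (b * τ₀) = 1 ∧ Real.sin (b * τ₀) = 0 := by
  rcases eq_or_ne b 0 with rfl | hb
  · exact ⟨τ₁ - 1, by linarith, by simp, by simp⟩
  · -- `τ₀ = 2πk/b` with an integer `k` on the correct side of `bτ₁/(2π)`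
    have key : ∀ k : ℤ, Real.cos (b * (k * (2 * Real.pi / b))) = 1 ∧
        Real.sin (b * (k * (2 * Real.pi / b))) = 0 := fun k => by
      have e : b * (k * (2 * Real.pi / b)) = k * (2 * Real.pi) := by
        field_simp
      rw [e, Real.cos_periodic.int_mul_eq k, Real.sin_periodic.int_mul_eq k, Real.cos_zero,
        Real.sin_zero]
      exact ⟨rfl, rfl⟩
    rcases lt_or_gt_of_ne hb with hneg | hpos
    · have hd : 2 * Real.pi / b < 0 := div_neg_of_pos_of_neg Real.two_pi_pos hneg
      obtain ⟨k, hk⟩ := exists_int_gt (τ₁ / (2 * Real.pi / b))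
      exact ⟨k * (2 * Real.pi / b), (div_lt_iff_of_neg hd).1 hk, key k⟩
    · have hd : 0 < 2 * Real.pi / b := div_pos Real.two_pi_pos hpos
      obtain ⟨k, hk⟩ := exists_int_lt (τ₁ / (2 * Real.pi / b))
      exact ⟨k * (2 * Real.pi / b), (lt_div_iff₀ hd).1 hk, key k⟩

/-! ### Bounds for the mode on `ℝ³`, `τ < 0`, `a ≥ 0` -/

section Bounds

/-- `‖c v‖ₑ ≤ ‖v‖ₑ` for `|c| ≤ 1`. [folklore] -/
theorem enorm_smul_le_of_abs_le_one {V : Type*} [NormedAddCommGroup V] [NormedSpace ℝ V] {c : ℝ}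
    (hc : |c| ≤ 1) (v : V) : ‖c • v‖ₑ ≤ ‖v‖ₑ := by
  rw [enorm_smul]
  calc ‖c‖ₑ * ‖v‖ₑ ≤ 1 * ‖v‖ₑ := by
        gcongr
        rw [Real.enorm_eq_ofReal_abs]
        exact ENNReal.ofReal_le_one.2 hc
    _ = ‖v‖ₑ := one_mul _

/-- The coefficients `e^{aτ}cos(bτ)`, `−e^{aτ}sin(bτ)` of the mode have modulus `≤ 1` for
`a ≥ 0`, `τ < 0`. [folklore] -/
theorem abs_coeff_le_one {a b τ : ℝ} (ha : 0 ≤ a) (hτ : τ < 0) :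
    |Real.exp (a * τ) * Real.cos (b * τ)| ≤ 1 ∧ |-(Real.exp (a * τ) * Real.sin (b * τ))| ≤ 1 := by
  have he0 : 0 ≤ Real.exp (a * τ) := (Real.exp_pos _).le
  have he1 : Real.exp (a * τ) ≤ 1 := Real.exp_le_one_iff.2 (mul_nonpos_of_nonneg_of_nonpos ha hτ.le)
  refine ⟨?_, ?_⟩
  · rw [abs_mul, abs_of_nonneg he0]
    calc Real.exp (a * τ) * |Real.cos (b * τ)| ≤ 1 * 1 := by
          gcongr
          exact Real.abs_cos_le_one _
      _ = 1 := one_mul _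
  · rw [abs_neg, abs_mul, abs_of_nonneg he0]
    calc Real.exp (a * τ) * |Real.sin (b * τ)| ≤ 1 * 1 := by
          gcongr
          exact Real.abs_sin_le_one _
      _ = 1 := one_mul _

variable {V : Type*} [NormedAddCommGroup V] [NormedSpace ℝ V]

/-- `∫‖c₁η₁ + c₂η₂‖² ≤ 2∫‖η₁‖² + 2∫‖η₂‖²` for `|cᵢ| ≤ 1` and continuous `η₁`. [folklore] -/
theorem lintegral_enorm_sq_lincomb_le {η₁ η₂ : EuclideanSpace ℝ (Fin 3) → V} (hη : Continuous η₁)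
    {c₁ c₂ : ℝ} (hc₁ : |c₁| ≤ 1) (hc₂ : |c₂| ≤ 1) :
    ∫⁻ ξ, ‖c₁ • η₁ ξ + c₂ • η₂ ξ‖ₑ ^ 2 ≤
      (2 * ∫⁻ ξ, ‖η₁ ξ‖ₑ ^ 2) + 2 * ∫⁻ ξ, ‖η₂ ξ‖ₑ ^ 2 := by
  have hm : AEMeasurable (fun ξ => ‖c₁ • η₁ ξ‖ₑ) (volume : Measure (EuclideanSpace ℝ (Fin 3))) :=
    (continuous_enorm.comp (hη.const_smul c₁)).aemeasurable
  refine (lintegral_enorm_add_sq_le hm _).trans ?_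
  gcongr with ξ ξ
  · exact enorm_smul_le_of_abs_le_one hc₁ _
  · exact enorm_smul_le_of_abs_le_one hc₂ _

variable {η₁ η₂ : EuclideanSpace ℝ (Fin 3) → EuclideanSpace ℝ (Fin 3)}

/-- `∫|∇(c₁η₁ + c₂η₂)|² ≤ 2∫|∇η₁|² + 2∫|∇η₂|²` for `|cᵢ| ≤ 1` and `C¹` profiles. [folklore] -/
theorem lintegral_frobeniusNormSq_fderiv_lincomb_le (h₁ : ContDiff ℝ 1 η₁) (h₂ : ContDiff ℝ 1 η₂)
    {c₁ c₂ : ℝ} (hc₁ : |c₁| ≤ 1) (hc₂ : |c₂| ≤ 1) :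
    ∫⁻ ξ, ENNReal.ofReal (frobeniusNormSq (fderiv ℝ (fun ζ => c₁ • η₁ ζ + c₂ • η₂ ζ) ξ)) ≤
      (2 * ∫⁻ ξ, ENNReal.ofReal (frobeniusNormSq (fderiv ℝ η₁ ξ))) +
        2 * ∫⁻ ξ, ENNReal.ofReal (frobeniusNormSq (fderiv ℝ η₂ ξ)) := by
  have hd₁ : Differentiable ℝ η₁ := h₁.differentiable one_ne_zero
  have hd₂ : Differentiable ℝ η₂ := h₂.differentiable one_ne_zero
  have hD : ∀ ξ, fderiv ℝ (fun ζ => c₁ • η₁ ζ + c₂ • η₂ ζ) ξ =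
      c₁ • fderiv ℝ η₁ ξ + c₂ • fderiv ℝ η₂ ξ := fun ξ => by
    rw [fderiv_fun_add ((hd₁ ξ).fun_const_smul c₁) ((hd₂ ξ).fun_const_smul c₂),
      fderiv_fun_const_smul (hd₁ ξ), fderiv_fun_const_smul (hd₂ ξ)]
  have hsq : ∀ {c : ℝ}, |c| ≤ 1 → c ^ 2 ≤ 1 := fun {c} hc => by
    rw [← sq_abs]
    exact pow_le_one₀ (abs_nonneg c) hc
  have hm : AEMeasurable (fun ξ => ENNReal.ofReal (frobeniusNormSq (c₁ • fderiv ℝ η₁ ξ)))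
      (volume : Measure (EuclideanSpace ℝ (Fin 3))) := by
    have e : (fun ξ => ENNReal.ofReal (frobeniusNormSq (c₁ • fderiv ℝ η₁ ξ))) =
        fun ξ => ENNReal.ofReal (c₁ ^ 2 * frobeniusNormSq (fderiv ℝ η₁ ξ)) :=
      funext fun ξ => by rw [frobeniusNormSq_smul]
    rw [e]
    exact (continuous_const.mul (continuous_frobeniusNormSq_fderiv' h₁)).aemeasurable.ennreal_ofReal
  calc ∫⁻ ξ, ENNReal.ofReal (frobeniusNormSq (fderiv ℝ (fun ζ => c₁ • η₁ ζ + c₂ • η₂ ζ) ξ))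
      = ∫⁻ ξ, ENNReal.ofReal (frobeniusNormSq (c₁ • fderiv ℝ η₁ ξ + c₂ • fderiv ℝ η₂ ξ)) :=
        lintegral_congr fun ξ => by rw [hD ξ]
    _ ≤ (2 * ∫⁻ ξ, ENNReal.ofReal (frobeniusNormSq (c₁ • fderiv ℝ η₁ ξ))) +
          2 * ∫⁻ ξ, ENNReal.ofReal (frobeniusNormSq (c₂ • fderiv ℝ η₂ ξ)) :=
        lintegral_frobeniusNormSq_add_le hm _
    _ ≤ (2 * ∫⁻ ξ, ENNReal.ofReal (frobeniusNormSq (fderiv ℝ η₁ ξ))) +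
          2 * ∫⁻ ξ, ENNReal.ofReal (frobeniusNormSq (fderiv ℝ η₂ ξ)) := by
        gcongr with ξ ξ
        · rw [frobeniusNormSq_smul]
          have h0 := frobeniusNormSq_nonneg (fderiv ℝ η₁ ξ)
          nlinarith [hsq hc₁]
        · rw [frobeniusNormSq_smul]
          have h0 := frobeniusNormSq_nonneg (fderiv ℝ η₂ ξ)
          nlinarith [hsq hc₂]

/-- `∫‖W‖³ ≤ B ∫‖W‖²` for a field bounded by `B`. [folklore] -/
theorem lintegral_enorm_cube_le_of_bound {W : EuclideanSpace ℝ (Fin 3) → EuclideanSpace ℝ (Fin 3)}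
    {B : ℝ} (hB : ∀ ξ, ‖W ξ‖ ≤ B) :
    ∫⁻ ξ, ‖W ξ‖ₑ ^ (3 : ℕ) ≤ ENNReal.ofReal B * ∫⁻ ξ, ‖W ξ‖ₑ ^ 2 := by
  rw [← lintegral_const_mul' _ _ ENNReal.ofReal_ne_top]
  refine lintegral_mono fun ξ => ?_
  calc ‖W ξ‖ₑ ^ (3 : ℕ) = ‖W ξ‖ₑ * ‖W ξ‖ₑ ^ 2 := by ring
    _ ≤ ENNReal.ofReal B * ‖W ξ‖ₑ ^ 2 := by
        gcongr
        rw [← ofReal_norm]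
        exact ENNReal.ofReal_le_ofReal (hB ξ)

/-- `∫‖W·∇W‖² ≤ B² ∫|∇W|²` for a field bounded by `B` (`‖DW(ξ)v‖ ≤ |DW(ξ)|_F ‖v‖`). [folklore] -/
theorem lintegral_enorm_convect_sq_le_of_bound
    {W : EuclideanSpace ℝ (Fin 3) → EuclideanSpace ℝ (Fin 3)} {B : ℝ} (hB : ∀ ξ, ‖W ξ‖ ≤ B) :
    ∫⁻ ξ, ‖convect W W ξ‖ₑ ^ 2 ≤
      ENNReal.ofReal (B ^ 2) * ∫⁻ ξ, ENNReal.ofReal (frobeniusNormSq (fderiv ℝ W ξ)) := by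
  rw [← lintegral_const_mul' _ _ ENNReal.ofReal_ne_top]
  refine lintegral_mono fun ξ => ?_
  rw [convect_apply, ← ofReal_norm, ← ENNReal.ofReal_pow (norm_nonneg _),
    ← ENNReal.ofReal_mul (sq_nonneg _)]
  refine ENNReal.ofReal_le_ofReal ?_
  have h1 : ‖fderiv ℝ W ξ (W ξ)‖ ≤ ‖fderiv ℝ W ξ‖ * B :=
    (ContinuousLinearMap.le_opNorm _ _).trans (by gcongr; exact hB ξ)
  have h2 : ‖fderiv ℝ W ξ‖ ^ 2 ≤ frobeniusNormSq (fderiv ℝ W ξ) := by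
    rw [frobeniusNormSq_eq_sum (stdOrthonormalBasis ℝ (EuclideanSpace ℝ (Fin 3)))]
    exact sq_opNorm_le_sum_sq_norm_apply _ _
  calc ‖fderiv ℝ W ξ (W ξ)‖ ^ 2 ≤ (‖fderiv ℝ W ξ‖ * B) ^ 2 :=
        pow_le_pow_left₀ (norm_nonneg _) h1 2
    _ = B ^ 2 * ‖fderiv ℝ W ξ‖ ^ 2 := by ring
    _ ≤ B ^ 2 * frobeniusNormSq (fderiv ℝ W ξ) := by gcongr

end Bounds

end AlbrittonBrueColombo2022

/-! ### Theorem 1.2 from an eigenmode -/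

section Final

open AlbrittonBrueColombo2022

/-- **Albritton–Brué–Colombo 2022, Thm. 1.2 (faithful rendering) from an unstable — or neutral —
eigenmode of `L_ss` at a steady profile with finite norms (the stationary form of Thm. 1.3 (a);
general smooth background).** Let `Ū : ℝ³ → ℝ³` be smooth and divergence free with
`Ū ∈ L² ∩ Ḣ¹ ∩ L³` and `F̄ = steadyForceProfile Ū ∈ L²` (e.g. `Ū ∈ C_c^∞`, or a Gaussian vortex
ring), `λ = a + ib` with `a ≥ 0`, and let `η = η₁ + iη₂`, `q = q₁ + iq₂` be smooth, `η`
divergence free, bounded, `η ∈ L² ∩ Ḣ¹`, `q ∈ L²`, solving classically on `ℝ³` the eigenvalue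
system `λη − ½(η + Dη·ξ) − Δη + Ū·∇η + η·∇Ū + ∇q = 0` — i.e. `L_ss η = λη` ((1.10),
Thm. 1.3 (a)) written with the pressure `∇q = −(1 − P)(Ū·∇η + η·∇Ū)` — in real form:
`aη₁ − bη₂ + N_Ū(η₁) + ∇q₁ = 0`, `bη₁ + aη₂ + N_Ū(η₂) + ∇q₂ = 0`
(`N_Ū = steadyLinearizedResidual Ū`), with `η₁ = Re η ≢ 0`. Then `albritton_brue_colombo_unit`
holds. Proof: `W(τ) := Re(e^{λτ}η)`, `Q(τ) := Re(e^{λτ}q)` (`reMode`) is a jointly smooth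
classical solution of the linearised system `Lin_Ū(W) + ∇Q = 0`, `div W = 0` on `τ < 0`
(`linearizedResidual_reMode`: it equals `e^{aτ}cos(bτ)·0 − e^{aτ}sin(bτ)·0`), with
`‖W(τ)‖₂² ≤ 2‖η₁‖₂² + 2‖η₂‖₂²`, `‖∇W(τ)‖₂² ≤ 2‖∇η₁‖₂² + 2‖∇η₂‖₂²`, `|W| ≤ 2K`,
`‖W‖₃³ ≤ 2K‖W‖₂²`, `‖W·∇W‖₂² ≤ 4K²‖∇W‖₂²`, `‖Q(τ)‖₂² ≤ 2‖q₁‖₂² + 2‖q₂‖₂²` uniformly in `τ < 0`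
because `e^{aτ} ≤ 1` (`a ≥ 0`), the force profile `F̄ + ¼W·∇W` bounded in `L²`
(`similarityResidual_const`), and `W(τ₀) = e^{aτ₀}η₁ ≢ 0` at a time `τ₀ < 0` with `bτ₀ ∈ 2πℤ`
(continuity: an a.e.-zero continuous field is zero); conclude by
`albritton_brue_colombo_unit_of_linearizedSolution` with the constant path `Ū` (symmetric split
`Ū ± ½W`, assembly of the two strict Leray–Hopf solutions). NOT proved here: the existence of
`(Ū, λ, η, q)` — the spectral core §§2–3 of the paper.
[cite: AlbrittonBrueColombo2022, Thm. 1.3 (a) (L_ss η = λη, U^lin = Re(e^{τλ}η)) and (1.10) ⟹ Thm. 1.2] -/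
theorem albritton_brue_colombo_unit_of_unstableMode'
    {Ubar : EuclideanSpace ℝ (Fin 3) → EuclideanSpace ℝ (Fin 3)} (hUs : ContDiff ℝ ∞ Ubar)
    (hUdiv : VectorCalculus.IsDivFree Ubar) (hU2 : ∫⁻ ξ, ‖Ubar ξ‖ₑ ^ 2 < ⊤)
    (hDU : ∫⁻ ξ, ENNReal.ofReal (frobeniusNormSq (fderiv ℝ Ubar ξ)) < ⊤)
    (hU3 : ∫⁻ ξ, ‖Ubar ξ‖ₑ ^ (3 : ℕ) < ⊤) (hF : ∫⁻ ξ, ‖steadyForceProfile Ubar ξ‖ₑ ^ 2 < ⊤)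
    {a b : ℝ} (ha : 0 ≤ a)
    {η₁ η₂ : EuclideanSpace ℝ (Fin 3) → EuclideanSpace ℝ (Fin 3)}
    {q₁ q₂ : EuclideanSpace ℝ (Fin 3) → ℝ}
    (hη₁ : ContDiff ℝ ∞ η₁) (hη₂ : ContDiff ℝ ∞ η₂) (hq₁ : ContDiff ℝ ∞ q₁) (hq₂ : ContDiff ℝ ∞ q₂)
    (hdiv₁ : VectorCalculus.IsDivFree η₁) (hdiv₂ : VectorCalculus.IsDivFree η₂)
    (heig₁ : ∀ ξ, a • η₁ ξ - b • η₂ ξ + steadyLinearizedResidual Ubar η₁ ξ + gradient q₁ ξ = 0)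
    (heig₂ : ∀ ξ, b • η₁ ξ + a • η₂ ξ + steadyLinearizedResidual Ubar η₂ ξ + gradient q₂ ξ = 0)
    {K : ℝ} (hK₁ : ∀ ξ, ‖η₁ ξ‖ ≤ K) (hK₂ : ∀ ξ, ‖η₂ ξ‖ ≤ K)
    (hI₁ : ∫⁻ ξ, ‖η₁ ξ‖ₑ ^ 2 < ⊤) (hI₂ : ∫⁻ ξ, ‖η₂ ξ‖ₑ ^ 2 < ⊤)
    (hJ₁ : ∫⁻ ξ, ENNReal.ofReal (frobeniusNormSq (fderiv ℝ η₁ ξ)) < ⊤)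
    (hJ₂ : ∫⁻ ξ, ENNReal.ofReal (frobeniusNormSq (fderiv ℝ η₂ ξ)) < ⊤)
    (hP₁ : ∫⁻ ξ, ‖q₁ ξ‖ₑ ^ 2 < ⊤) (hP₂ : ∫⁻ ξ, ‖q₂ ξ‖ₑ ^ 2 < ⊤)
    (hne : ∃ ξ₀, η₁ ξ₀ ≠ 0) :
    albritton_brue_colombo_unit := by
  -- regularity of the profiles
  have hη₁2 : ContDiff ℝ 2 η₁ := hη₁.of_le (by norm_cast)
  have hη₂2 : ContDiff ℝ 2 η₂ := hη₂.of_le (by norm_cast)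
  have hη₁1 : ContDiff ℝ 1 η₁ := hη₁.of_le (by norm_cast)
  have hη₂1 : ContDiff ℝ 1 η₂ := hη₂.of_le (by norm_cast)
  have hd₁ : Differentiable ℝ η₁ := hη₁.differentiable (by simp)
  have hd₂ : Differentiable ℝ η₂ := hη₂.differentiable (by simp)
  have hqd₁ : Differentiable ℝ q₁ := hq₁.differentiable (by simp)
  have hqd₂ : Differentiable ℝ q₂ := hq₂.differentiable (by simp)
  -- the constant background path is jointly smooth; its residual is `F̄`
  have hU : IsSmoothSpaceTimeOn (Iio 0) (fun _ : ℝ => Ubar) := by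
    change ContDiffOn ℝ ∞ (fun z : ℝ × EuclideanSpace ℝ (Fin 3) => Ubar z.2) (Iio 0 ×ˢ univ)
    exact (hUs.comp contDiff_snd).contDiffOn
  -- joint smoothness of the mode and of its pressure
  have hW : IsSmoothSpaceTimeOn (Iio 0) (reMode a b η₁ η₂) := isSmoothSpaceTimeOn_reMode hη₁ hη₂ a b _
  have hQ : IsSmoothSpaceTimeOn (Iio 0) (reMode a b q₁ q₂) := isSmoothSpaceTimeOn_reMode hq₁ hq₂ a b _
  -- incompressibility of the slices
  have hWdiv : ∀ τ < (0 : ℝ), VectorCalculus.IsDivFree (reMode a b η₁ η₂ τ) := fun τ _ => by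
    rw [reMode_slice]
    exact isDivFree_lincomb hd₁ hd₂ hdiv₁ hdiv₂ _ _
  -- the linearised system
  have hlin : ∀ τ < (0 : ℝ), ∀ ξ,
      linearizedResidual (Iio 0) (fun _ => Ubar) (reMode a b η₁ η₂) τ ξ +
        gradient (reMode a b q₁ q₂ τ) ξ = 0 := fun τ hτ ξ => by
    rw [linearizedResidual_reMode (isOpen_Iio.uniqueDiffWithinAt hτ) Ubar hη₁2 hη₂2 hqd₁ hqd₂ ξ,
      heig₁ ξ, heig₂ ξ, smul_zero, smul_zero, add_zero]
  -- the sup bound `|W(τ)| ≤ 2K` on `τ < 0`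
  have hsup : ∀ τ < (0 : ℝ), ∀ ξ, ‖reMode a b η₁ η₂ τ ξ‖ ≤ 2 * K := fun τ hτ ξ => by
    obtain ⟨hc₁, hc₂⟩ := abs_coeff_le_one (b := b) ha hτ
    rw [reMode_eq]
    calc ‖(Real.exp (a * τ) * Real.cos (b * τ)) • η₁ ξ +
          (-(Real.exp (a * τ) * Real.sin (b * τ))) • η₂ ξ‖
        ≤ ‖(Real.exp (a * τ) * Real.cos (b * τ)) • η₁ ξ‖ +
            ‖(-(Real.exp (a * τ) * Real.sin (b * τ))) • η₂ ξ‖ := norm_add_le _ _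
      _ ≤ 1 * K + 1 * K := by
          rw [norm_smul, norm_smul, Real.norm_eq_abs, Real.norm_eq_abs]
          gcongr
          · exact hK₁ ξ
          · exact hK₂ ξ
      _ = 2 * K := by ring
  -- the bounds on the mode
  set L2 : ℝ≥0∞ := (2 * ∫⁻ ξ, ‖η₁ ξ‖ₑ ^ 2) + 2 * ∫⁻ ξ, ‖η₂ ξ‖ₑ ^ 2 with hL2_def
  set H1 : ℝ≥0∞ := (2 * ∫⁻ ξ, ENNReal.ofReal (frobeniusNormSq (fderiv ℝ η₁ ξ))) +
      2 * ∫⁻ ξ, ENNReal.ofReal (frobeniusNormSq (fderiv ℝ η₂ ξ)) with hH1_def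
  set PP : ℝ≥0∞ := (2 * ∫⁻ ξ, ‖q₁ ξ‖ₑ ^ 2) + 2 * ∫⁻ ξ, ‖q₂ ξ‖ₑ ^ 2 with hPP_def
  have hL2t : L2 ≠ ⊤ := ENNReal.add_ne_top.2
    ⟨ENNReal.mul_ne_top (by norm_num) hI₁.ne, ENNReal.mul_ne_top (by norm_num) hI₂.ne⟩
  have hH1t : H1 ≠ ⊤ := ENNReal.add_ne_top.2
    ⟨ENNReal.mul_ne_top (by norm_num) hJ₁.ne, ENNReal.mul_ne_top (by norm_num) hJ₂.ne⟩
  have hPPt : PP ≠ ⊤ := ENNReal.add_ne_top.2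
    ⟨ENNReal.mul_ne_top (by norm_num) hP₁.ne, ENNReal.mul_ne_top (by norm_num) hP₂.ne⟩
  have hW2 : ∀ τ < (0 : ℝ), ∫⁻ ξ, ‖reMode a b η₁ η₂ τ ξ‖ₑ ^ 2 ≤ L2 := fun τ hτ => by
    obtain ⟨hc₁, hc₂⟩ := abs_coeff_le_one (b := b) ha hτ
    rw [reMode_slice]
    exact lintegral_enorm_sq_lincomb_le hη₁.continuous hc₁ hc₂
  have hDW : ∀ τ < (0 : ℝ),
      ∫⁻ ξ, ENNReal.ofReal (frobeniusNormSq (fderiv ℝ (reMode a b η₁ η₂ τ) ξ)) ≤ H1 := fun τ hτ => by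
    obtain ⟨hc₁, hc₂⟩ := abs_coeff_le_one (b := b) ha hτ
    rw [reMode_slice]
    exact lintegral_frobeniusNormSq_fderiv_lincomb_le hη₁1 hη₂1 hc₁ hc₂
  have hW3 : ∀ τ < (0 : ℝ),
      ∫⁻ ξ, ‖reMode a b η₁ η₂ τ ξ‖ₑ ^ (3 : ℕ) ≤ ENNReal.ofReal (2 * K) * L2 := fun τ hτ =>
    (lintegral_enorm_cube_le_of_bound (hsup τ hτ)).trans (by gcongr; exact hW2 τ hτ)
  have hWW : ∀ τ < (0 : ℝ),
      ∫⁻ ξ, ‖convect (reMode a b η₁ η₂ τ) (reMode a b η₁ η₂ τ) ξ‖ₑ ^ 2 ≤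
        ENNReal.ofReal ((2 * K) ^ 2) * H1 := fun τ hτ =>
    (lintegral_enorm_convect_sq_le_of_bound (hsup τ hτ)).trans (by gcongr; exact hDW τ hτ)
  have hQ2 : ∀ τ < (0 : ℝ), ∫⁻ ξ, ‖reMode a b q₁ q₂ τ ξ‖ₑ ^ 2 ≤ PP := fun τ hτ => by
    obtain ⟨hc₁, hc₂⟩ := abs_coeff_le_one (b := b) ha hτ
    rw [reMode_slice]
    exact lintegral_enorm_sq_lincomb_le hq₁.continuous hc₁ hc₂
  -- the force profile `F̄ + ¼ W·∇W` is bounded in `L²`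
  have hFm : AEMeasurable (fun ξ => ‖steadyForceProfile Ubar ξ‖ₑ)
      (volume : Measure (EuclideanSpace ℝ (Fin 3))) :=
    (continuous_steadyForceProfile (hUs.of_le (by norm_cast))).aemeasurable.enorm
  have hF2 : ∀ τ < (0 : ℝ), ∫⁻ ξ, ‖similarityResidual (Iio 0) (fun _ => Ubar) τ ξ +
      (4⁻¹ : ℝ) • convect (reMode a b η₁ η₂ τ) (reMode a b η₁ η₂ τ) ξ‖ₑ ^ 2 ≤
        (2 * ∫⁻ ξ, ‖steadyForceProfile Ubar ξ‖ₑ ^ 2) + 2 * (ENNReal.ofReal ((2 * K) ^ 2) * H1) := by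
    intro τ hτ
    have h4 : |(4⁻¹ : ℝ)| ≤ 1 := by norm_num
    calc ∫⁻ ξ, ‖similarityResidual (Iio 0) (fun _ => Ubar) τ ξ +
          (4⁻¹ : ℝ) • convect (reMode a b η₁ η₂ τ) (reMode a b η₁ η₂ τ) ξ‖ₑ ^ 2
        = ∫⁻ ξ, ‖steadyForceProfile Ubar ξ +
            (4⁻¹ : ℝ) • convect (reMode a b η₁ η₂ τ) (reMode a b η₁ η₂ τ) ξ‖ₑ ^ 2 :=
          lintegral_congr fun ξ => by rw [similarityResidual_const]
      _ ≤ (2 * ∫⁻ ξ, ‖steadyForceProfile Ubar ξ‖ₑ ^ 2) +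
            2 * ∫⁻ ξ, ‖(4⁻¹ : ℝ) • convect (reMode a b η₁ η₂ τ) (reMode a b η₁ η₂ τ) ξ‖ₑ ^ 2 :=
          lintegral_enorm_add_sq_le hFm _
      _ ≤ (2 * ∫⁻ ξ, ‖steadyForceProfile Ubar ξ‖ₑ ^ 2) +
            2 * ∫⁻ ξ, ‖convect (reMode a b η₁ η₂ τ) (reMode a b η₁ η₂ τ) ξ‖ₑ ^ 2 := by
          gcongr with ξ
          exact enorm_smul_le_of_abs_le_one h4 _
      _ ≤ (2 * ∫⁻ ξ, ‖steadyForceProfile Ubar ξ‖ₑ ^ 2) + 2 * (ENNReal.ofReal ((2 * K) ^ 2) * H1) := by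
          gcongr
          exact hWW τ hτ
  -- the common constant
  set KU : ℝ≥0∞ := (∫⁻ ξ, ‖Ubar ξ‖ₑ ^ 2) + (∫⁻ ξ, ENNReal.ofReal (frobeniusNormSq (fderiv ℝ Ubar ξ))) +
      (∫⁻ ξ, ‖Ubar ξ‖ₑ ^ (3 : ℕ)) +
      ((2 * ∫⁻ ξ, ‖steadyForceProfile Ubar ξ‖ₑ ^ 2) + 2 * (ENNReal.ofReal ((2 * K) ^ 2) * H1))
    with hKU_def
  have hKUt : KU ≠ ⊤ := by
    rw [hKU_def]
    exact ENNReal.add_ne_top.2 ⟨ENNReal.add_ne_top.2 ⟨ENNReal.add_ne_top.2 ⟨hU2.ne, hDU.ne⟩, hU3.ne⟩,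
      ENNReal.add_ne_top.2 ⟨ENNReal.mul_ne_top (by norm_num) hF.ne,
        ENNReal.mul_ne_top (by norm_num) (ENNReal.mul_ne_top ENNReal.ofReal_ne_top hH1t)⟩⟩
  set M : ℝ≥0∞ := L2 + H1 + ENNReal.ofReal (2 * K) * L2 + ENNReal.ofReal ((2 * K) ^ 2) * H1 + PP + KU
    with hM_def
  have hMt : M ≠ ⊤ := by
    rw [hM_def]
    exact ENNReal.add_ne_top.2 ⟨ENNReal.add_ne_top.2 ⟨ENNReal.add_ne_top.2 ⟨ENNReal.add_ne_top.2
      ⟨ENNReal.add_ne_top.2 ⟨hL2t, hH1t⟩, ENNReal.mul_ne_top ENNReal.ofReal_ne_top hL2t⟩,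
      ENNReal.mul_ne_top ENNReal.ofReal_ne_top hH1t⟩, hPPt⟩, hKUt⟩
  have h1 : L2 ≤ M := by
    rw [hM_def]
    exact le_add_right (le_add_right (le_add_right (le_add_right (le_add_right le_rfl))))
  have h2 : H1 ≤ M := by
    rw [hM_def]
    exact le_add_right (le_add_right (le_add_right (le_add_right (le_add_left le_rfl))))
  have h3 : ENNReal.ofReal (2 * K) * L2 ≤ M := by
    rw [hM_def]; exact le_add_right (le_add_right (le_add_right (le_add_left le_rfl)))
  have h4 : ENNReal.ofReal ((2 * K) ^ 2) * H1 ≤ M := by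
    rw [hM_def]; exact le_add_right (le_add_right (le_add_left le_rfl))
  have h5 : PP ≤ M := by
    rw [hM_def]; exact le_add_right (le_add_left le_rfl)
  have hKUM : KU ≤ M := by
    rw [hM_def]; exact le_add_left le_rfl
  have h6 : ∫⁻ ξ, ‖Ubar ξ‖ₑ ^ 2 ≤ M := by
    refine le_trans ?_ hKUM
    rw [hKU_def]; exact le_add_right (le_add_right (le_add_right le_rfl))
  have h7 : ∫⁻ ξ, ENNReal.ofReal (frobeniusNormSq (fderiv ℝ Ubar ξ)) ≤ M := by
    refine le_trans ?_ hKUM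
    rw [hKU_def]; exact le_add_right (le_add_right (le_add_left le_rfl))
  have h8 : ∫⁻ ξ, ‖Ubar ξ‖ₑ ^ (3 : ℕ) ≤ M := by
    refine le_trans ?_ hKUM
    rw [hKU_def]; exact le_add_right (le_add_left le_rfl)
  have h9 : (2 * ∫⁻ ξ, ‖steadyForceProfile Ubar ξ‖ₑ ^ 2) +
      2 * (ENNReal.ofReal ((2 * K) ^ 2) * H1) ≤ M := by
    refine le_trans ?_ hKUM
    rw [hKU_def]; exact le_add_left le_rfl
  -- nontriviality: `W(τ₀) = e^{aτ₀} η₁ ≢ 0` at a time with `bτ₀ ∈ 2πℤ`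
  have hne' : ∃ τ₀ < (0 : ℝ), ¬ (reMode a b η₁ η₂ τ₀ =ᵐ[volume] 0) := by
    obtain ⟨ξ₀, hξ₀⟩ := hne
    obtain ⟨τ₀, hτ₀, hcos, hsin⟩ := exists_lt_cos_eq_one_sin_eq_zero b 0
    refine ⟨τ₀, hτ₀, fun hae => ?_⟩
    have hcont : Continuous (reMode a b η₁ η₂ τ₀) :=
      (hW.contDiff_slice (show τ₀ ∈ Iio (0 : ℝ) from hτ₀)).continuous
    have heq : reMode a b η₁ η₂ τ₀ = 0 :=
      (Continuous.ae_eq_iff_eq volume hcont continuous_zero).1 hae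
    have h0 := congr_fun heq ξ₀
    rw [reMode_apply, hcos, hsin, one_smul, zero_smul, sub_zero, Pi.zero_apply] at h0
    exact smul_ne_zero (Real.exp_pos _).ne' hξ₀ h0
  exact albritton_brue_colombo_unit_of_linearizedSolution hU hW hQ (fun τ _ => hUdiv) hWdiv hlin hMt
    (fun τ _ => h6) (fun τ hτ => (hW2 τ hτ).trans h1) (fun τ _ => h7)
    (fun τ hτ => (hDW τ hτ).trans h2) (fun τ _ => h8) (fun τ hτ => (hW3 τ hτ).trans h3)
    (fun τ hτ => (hQ2 τ hτ).trans h5) (fun τ hτ => (hF2 τ hτ).trans h9) hne'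

/-- **Albritton–Brué–Colombo 2022, Thm. 1.2 (faithful rendering) from an unstable — or neutral —
eigenmode of `L_ss` (the stationary form of Thm. 1.3 (a), paper-shaped: `Ū ∈ C_c^∞`).** Let
`Ū ∈ C_c^∞(ℝ³; ℝ³)` be divergence free, `λ = a + ib` with `a ≥ 0`, and let `η = η₁ + iη₂`,
`q = q₁ + iq₂` be smooth, `η` divergence free, bounded, `η ∈ L² ∩ Ḣ¹`, `q ∈ L²`, solving
classically on `ℝ³` the eigenvalue system `λη − ½(η + Dη·ξ) − Δη + Ū·∇η + η·∇Ū + ∇q = 0` — i.e.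
`L_ss η = λη` ((1.10), Thm. 1.3 (a)) written with the pressure `∇q = −(1 − P)(Ū·∇η + η·∇Ū)` —
in real form: `aη₁ − bη₂ + N_Ū(η₁) + ∇q₁ = 0`, `bη₁ + aη₂ + N_Ū(η₂) + ∇q₂ = 0`
(`N_Ū = steadyLinearizedResidual Ū`), with `η₁ = Re η ≢ 0`. Then `albritton_brue_colombo_unit`
holds (`albritton_brue_colombo_unit_of_unstableMode'`: the norms of `Ū` and of
`F̄ = steadyForceProfile Ū ∈ C_c` are finite). In the paper `Ū` is the truncated Vishik vortex
ring and `a = Re λ > 0` (Thm. 1.3 (a), from Cor. 3.2 / Thm. 3.1 and §2), `η ∈ H^k` for all `k`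
(hence smooth, bounded, `L² ∩ Ḣ¹`), `q = −Δ⁻¹ div div(Ū ⊗ η + η ⊗ Ū) ∈ L²`, and the second
solution uses moreover the nonlinear part (b) (Thm. 4.1), not needed here. NOT proved here: the
existence of `(Ū, λ, η, q)` — the spectral core §§2–3 of the paper.
[cite: AlbrittonBrueColombo2022, Thm. 1.3 (a) (L_ss η = λη, U^lin = Re(e^{τλ}η)) and (1.10) ⟹ Thm. 1.2] -/
theorem albritton_brue_colombo_unit_of_unstableMode
    {Ubar : EuclideanSpace ℝ (Fin 3) → EuclideanSpace ℝ (Fin 3)} (hUs : ContDiff ℝ ∞ Ubar)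
    (hUc : HasCompactSupport Ubar) (hUdiv : VectorCalculus.IsDivFree Ubar) {a b : ℝ} (ha : 0 ≤ a)
    {η₁ η₂ : EuclideanSpace ℝ (Fin 3) → EuclideanSpace ℝ (Fin 3)}
    {q₁ q₂ : EuclideanSpace ℝ (Fin 3) → ℝ}
    (hη₁ : ContDiff ℝ ∞ η₁) (hη₂ : ContDiff ℝ ∞ η₂) (hq₁ : ContDiff ℝ ∞ q₁) (hq₂ : ContDiff ℝ ∞ q₂)
    (hdiv₁ : VectorCalculus.IsDivFree η₁) (hdiv₂ : VectorCalculus.IsDivFree η₂)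
    (heig₁ : ∀ ξ, a • η₁ ξ - b • η₂ ξ + steadyLinearizedResidual Ubar η₁ ξ + gradient q₁ ξ = 0)
    (heig₂ : ∀ ξ, b • η₁ ξ + a • η₂ ξ + steadyLinearizedResidual Ubar η₂ ξ + gradient q₂ ξ = 0)
    {K : ℝ} (hK₁ : ∀ ξ, ‖η₁ ξ‖ ≤ K) (hK₂ : ∀ ξ, ‖η₂ ξ‖ ≤ K)
    (hI₁ : ∫⁻ ξ, ‖η₁ ξ‖ₑ ^ 2 < ⊤) (hI₂ : ∫⁻ ξ, ‖η₂ ξ‖ₑ ^ 2 < ⊤)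
    (hJ₁ : ∫⁻ ξ, ENNReal.ofReal (frobeniusNormSq (fderiv ℝ η₁ ξ)) < ⊤)
    (hJ₂ : ∫⁻ ξ, ENNReal.ofReal (frobeniusNormSq (fderiv ℝ η₂ ξ)) < ⊤)
    (hP₁ : ∫⁻ ξ, ‖q₁ ξ‖ₑ ^ 2 < ⊤) (hP₂ : ∫⁻ ξ, ‖q₂ ξ‖ₑ ^ 2 < ⊤)
    (hne : ∃ ξ₀, η₁ ξ₀ ≠ 0) :
    albritton_brue_colombo_unit :=
  have hUcont : Continuous Ubar := hUs.continuous
  albritton_brue_colombo_unit_of_unstableMode' hUs hUdiv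
    (lintegral_enorm_sq_lt_top_of_hasCompactSupport hUcont hUc)
    (lintegral_frobeniusNormSq_lt_top_of_hasCompactSupport (hUs.of_le (by norm_cast)) hUc)
    (lintegral_enorm_cube_lt_top_of_hasCompactSupport hUcont hUc)
    (lintegral_enorm_sq_lt_top_of_hasCompactSupport
      (continuous_steadyForceProfile (hUs.of_le (by norm_cast)))
      (hasCompactSupport_steadyForceProfile hUc))
    ha hη₁ hη₂ hq₁ hq₂ hdiv₁ hdiv₂ heig₁ heig₂ hK₁ hK₂ hI₁ hI₂ hJ₁ hJ₂ hP₁ hP₂ hne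

/-- **Albritton–Brué–Colombo 2022, Thm. 1.2 from a REAL unstable (or neutral) eigenvalue of
`L_ss`**: `Ū ∈ C_c^∞(ℝ³;ℝ³)` divergence free, `a ≥ 0`, and a smooth bounded divergence-free
`η ∈ L² ∩ Ḣ¹`, `η ≢ 0`, with a smooth `q ∈ L²`, solving `aη − ½(η + Dη·ξ) − Δη + Ū·∇η + η·∇Ū + ∇q = 0`
classically (i.e. `L_ss η = aη`), give `albritton_brue_colombo_unit`
(`albritton_brue_colombo_unit_of_unstableMode` with `b = 0`, `η₂ = 0`, `q₂ = 0`; the mode is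
`W(τ) = e^{aτ}η`). [cite: AlbrittonBrueColombo2022, Thm. 1.3 (a) and (1.10) ⟹ Thm. 1.2] -/
theorem albritton_brue_colombo_unit_of_realUnstableMode
    {Ubar : EuclideanSpace ℝ (Fin 3) → EuclideanSpace ℝ (Fin 3)} (hUs : ContDiff ℝ ∞ Ubar)
    (hUc : HasCompactSupport Ubar) (hUdiv : VectorCalculus.IsDivFree Ubar) {a : ℝ} (ha : 0 ≤ a)
    {η : EuclideanSpace ℝ (Fin 3) → EuclideanSpace ℝ (Fin 3)} {q : EuclideanSpace ℝ (Fin 3) → ℝ}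
    (hη : ContDiff ℝ ∞ η) (hq : ContDiff ℝ ∞ q) (hdiv : VectorCalculus.IsDivFree η)
    (heig : ∀ ξ, a • η ξ + steadyLinearizedResidual Ubar η ξ + gradient q ξ = 0)
    {K : ℝ} (hK : ∀ ξ, ‖η ξ‖ ≤ K) (hI : ∫⁻ ξ, ‖η ξ‖ₑ ^ 2 < ⊤)
    (hJ : ∫⁻ ξ, ENNReal.ofReal (frobeniusNormSq (fderiv ℝ η ξ)) < ⊤)
    (hP : ∫⁻ ξ, ‖q ξ‖ₑ ^ 2 < ⊤) (hne : ∃ ξ₀, η ξ₀ ≠ 0) :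
    albritton_brue_colombo_unit := by
  have hK0 : 0 ≤ K := (norm_nonneg _).trans (hK 0)
  have hdiv0 : VectorCalculus.IsDivFree (fun _ : EuclideanSpace ℝ (Fin 3) =>
      (0 : EuclideanSpace ℝ (Fin 3))) := fun ξ => by
    have h0 : (fun _ : EuclideanSpace ℝ (Fin 3) => (0 : EuclideanSpace ℝ (Fin 3))) =
        (0 : EuclideanSpace ℝ (Fin 3) → EuclideanSpace ℝ (Fin 3)) := rfl
    rw [VectorCalculus.divergence, h0, fderiv_zero]
    simp
  have hgrad0 : ∀ ξ : EuclideanSpace ℝ (Fin 3),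
      gradient (fun _ : EuclideanSpace ℝ (Fin 3) => (0 : ℝ)) ξ = 0 := fun ξ => by
    have h0 : (fun _ : EuclideanSpace ℝ (Fin 3) => (0 : ℝ)) =
        (0 : EuclideanSpace ℝ (Fin 3) → ℝ) := rfl
    rw [gradient, h0, fderiv_zero]
    simp
  refine albritton_brue_colombo_unit_of_unstableMode hUs hUc hUdiv (b := 0) ha
    (η₂ := fun _ => 0) (q₂ := fun _ => 0) hη contDiff_const hq contDiff_const hdiv hdiv0
    (fun ξ => ?_) (fun ξ => ?_) hK (fun ξ => by simpa using hK0) hI (by simp) hJ ?_ hP (by simp) hne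
  · rw [zero_smul, sub_zero]
    exact heig ξ
  · rw [zero_smul, smul_zero, zero_add, zero_add, steadyLinearizedResidual_zero, hgrad0, add_zero]
  · simp [frobeniusNormSq_zero]

/-- **ns.S20 (`albritton_brue_colombo`, every viscosity) from an eigenmode of `L_ss`**, by
`albritton_brue_colombo_unit_of_unstableMode` and the viscosity scaling
`albritton_brue_colombo_of_unit` (`NSLerayHopfABCScaling.lean`). [cite: AlbrittonBrueColombo2022, Thm. 1.3 (a) ⟹ Thm. 1.2] -/
theorem albritton_brue_colombo_of_unstableMode
    {Ubar : EuclideanSpace ℝ (Fin 3) → EuclideanSpace ℝ (Fin 3)} (hUs : ContDiff ℝ ∞ Ubar)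
    (hUc : HasCompactSupport Ubar) (hUdiv : VectorCalculus.IsDivFree Ubar) {a b : ℝ} (ha : 0 ≤ a)
    {η₁ η₂ : EuclideanSpace ℝ (Fin 3) → EuclideanSpace ℝ (Fin 3)}
    {q₁ q₂ : EuclideanSpace ℝ (Fin 3) → ℝ}
    (hη₁ : ContDiff ℝ ∞ η₁) (hη₂ : ContDiff ℝ ∞ η₂) (hq₁ : ContDiff ℝ ∞ q₁) (hq₂ : ContDiff ℝ ∞ q₂)
    (hdiv₁ : VectorCalculus.IsDivFree η₁) (hdiv₂ : VectorCalculus.IsDivFree η₂)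
    (heig₁ : ∀ ξ, a • η₁ ξ - b • η₂ ξ + steadyLinearizedResidual Ubar η₁ ξ + gradient q₁ ξ = 0)
    (heig₂ : ∀ ξ, b • η₁ ξ + a • η₂ ξ + steadyLinearizedResidual Ubar η₂ ξ + gradient q₂ ξ = 0)
    {K : ℝ} (hK₁ : ∀ ξ, ‖η₁ ξ‖ ≤ K) (hK₂ : ∀ ξ, ‖η₂ ξ‖ ≤ K)
    (hI₁ : ∫⁻ ξ, ‖η₁ ξ‖ₑ ^ 2 < ⊤) (hI₂ : ∫⁻ ξ, ‖η₂ ξ‖ₑ ^ 2 < ⊤)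
    (hJ₁ : ∫⁻ ξ, ENNReal.ofReal (frobeniusNormSq (fderiv ℝ η₁ ξ)) < ⊤)
    (hJ₂ : ∫⁻ ξ, ENNReal.ofReal (frobeniusNormSq (fderiv ℝ η₂ ξ)) < ⊤)
    (hP₁ : ∫⁻ ξ, ‖q₁ ξ‖ₑ ^ 2 < ⊤) (hP₂ : ∫⁻ ξ, ‖q₂ ξ‖ₑ ^ 2 < ⊤)
    (hne : ∃ ξ₀, η₁ ξ₀ ≠ 0) :
    albritton_brue_colombo :=
  albritton_brue_colombo_of_unit
    (albritton_brue_colombo_unit_of_unstableMode hUs hUc hUdiv ha hη₁ hη₂ hq₁ hq₂ hdiv₁ hdiv₂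
      heig₁ heig₂ hK₁ hK₂ hI₁ hI₂ hJ₁ hJ₂ hP₁ hP₂ hne)

end Final

/-! ### The operator `−L_ss` of (1.10) with the classical Leray projection, and Thm. 1.2 from
`L_ss η = λη` verbatim -/

namespace AlbrittonBrueColombo2022

variable {E' : Type*} [NormedAddCommGroup E'] [InnerProductSpace ℝ E']

/-- **The symmetrised convection `B(Ū, η) := Ū·∇η + η·∇Ū`** (the first-order part of the
linearisation (1.10) of `U·∇U` at `Ū`). [cite: AlbrittonBrueColombo2022, §1.1 (1.10)] -/
def symConvect (Ubar η : E' → E') (ξ : E') : E' :=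
  convect Ubar η ξ + convect η Ubar ξ

/-- Unfolding `symConvect`. [cite: AlbrittonBrueColombo2022, §1.1 (1.10)] -/
theorem symConvect_apply (Ubar η : E' → E') (ξ : E') :
    symConvect Ubar η ξ = convect Ubar η ξ + convect η Ubar ξ := rfl

/-- **The linearised operator `−L_ss` of Albritton–Brué–Colombo 2022, (1.10), verbatim**:
`−L_ss η = −½(1 + ξ·∇)η − Δη + P(Ū·∇η + η·∇Ū)` with `P` the Leray projector, here the
classical Leray projection `classicalLerayProj` (`P[G] = G − ∇Δ⁻¹div G` for the compactly
supported smooth field `G = B(Ū, η)` when `Ū ∈ C_c^∞`). The eigenvalue problem of Thm. 1.3 (a)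
is `L_ss η = λη`, i.e. `λη + negLss Ū η = 0`. [cite: AlbrittonBrueColombo2022, §1.1 (1.10) and Thm. 1.3 (a)] -/
def negLss (Ubar η : EuclideanSpace ℝ (Fin 3) → EuclideanSpace ℝ (Fin 3))
    (ξ : EuclideanSpace ℝ (Fin 3)) : EuclideanSpace ℝ (Fin 3) :=
  -((2⁻¹ : ℝ) • (η ξ + fderiv ℝ η ξ ξ)) - (Δ η) ξ + classicalLerayProj (symConvect Ubar η) ξ

/-- Unfolding `negLss`. [cite: AlbrittonBrueColombo2022, §1.1 (1.10)] -/
theorem negLss_apply (Ubar η : EuclideanSpace ℝ (Fin 3) → EuclideanSpace ℝ (Fin 3))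
    (ξ : EuclideanSpace ℝ (Fin 3)) :
    negLss Ubar η ξ =
      -((2⁻¹ : ℝ) • (η ξ + fderiv ℝ η ξ ξ)) - (Δ η) ξ + classicalLerayProj (symConvect Ubar η) ξ :=
  rfl

/-- **`−L_ss η = N_Ū(η) − ∇π[B(Ū,η)]`**: the projected operator (1.10) is the pressure-free
stationary operator `steadyLinearizedResidual` plus the pressure gradient `∇q`,
`q = −π[B(Ū, η)] = −Δ⁻¹ div (Ū·∇η + η·∇Ū)` (`(1 − P)B = ∇Δ⁻¹div B`). [cite: AlbrittonBrueColombo2022, §1.1 (1.10)] -/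
theorem negLss_eq_steadyLinearizedResidual_sub
    (Ubar η : EuclideanSpace ℝ (Fin 3) → EuclideanSpace ℝ (Fin 3)) (ξ : EuclideanSpace ℝ (Fin 3)) :
    negLss Ubar η ξ =
      steadyLinearizedResidual Ubar η ξ - gradient (divPotential (symConvect Ubar η)) ξ := by
  rw [negLss_apply, steadyLinearizedResidual_apply, classicalLerayProj_apply, symConvect_apply]
  abel

variable {Ubar η : EuclideanSpace ℝ (Fin 3) → EuclideanSpace ℝ (Fin 3)}

/-- `B(Ū, η)` is smooth for smooth `Ū`, `η`. [folklore] -/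
theorem contDiff_symConvect (hU : ContDiff ℝ ∞ Ubar) (hη : ContDiff ℝ ∞ η) :
    ContDiff ℝ ∞ (symConvect Ubar η) := by
  have hDη : ContDiff ℝ ∞ (fderiv ℝ η) := (contDiff_infty_iff_fderiv.1 hη).2
  have hDU : ContDiff ℝ ∞ (fderiv ℝ Ubar) := (contDiff_infty_iff_fderiv.1 hU).2
  change ContDiff ℝ ∞ fun ξ => fderiv ℝ η ξ (Ubar ξ) + fderiv ℝ Ubar ξ (η ξ)
  exact (hDη.clm_apply hU).add (hDU.clm_apply hη)

/-- `B(Ū, η)` is supported in the support of `Ū` (both `Ū` and `DŪ` vanish off `tsupport Ū`),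
hence compactly supported when `Ū` is. [folklore] -/
theorem hasCompactSupport_symConvect (hUc : HasCompactSupport Ubar) (η : EuclideanSpace ℝ (Fin 3) →
    EuclideanSpace ℝ (Fin 3)) : HasCompactSupport (symConvect Ubar η) := by
  refine hUc.mono' fun ξ hξ => ?_
  by_contra h
  have h0 : Ubar ξ = 0 := image_eq_zero_of_notMem_tsupport h
  have h1 : fderiv ℝ Ubar ξ = 0 :=
    image_eq_zero_of_notMem_tsupport fun h' => h (tsupport_fderiv_subset ℝ h')
  apply hξ
  simp [symConvect, convect, h0, h1]

end AlbrittonBrueColombo2022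

section Eigenmode

open AlbrittonBrueColombo2022

/-- `∇(−p) = −∇p`. [folklore] -/
theorem gradient_fun_neg' {F'' : Type*} [NormedAddCommGroup F''] [InnerProductSpace ℝ F'']
    [CompleteSpace F''] (p : F'' → ℝ) (x : F'') :
    gradient (fun y => -p y) x = -gradient p x := by
  simp only [gradient, fderiv_fun_neg, map_neg]

/-- **Albritton–Brué–Colombo 2022, Thm. 1.2 (faithful rendering) from an eigenmode
`L_ss η = λη` of the operator (1.10) VERBATIM — no pressure in the hypotheses.** Let
`Ū ∈ C_c^∞(ℝ³; ℝ³)` be divergence free and let `λ = a + ib` with `a = Re λ ≥ 0` and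
`η = η₁ + iη₂` with `η₁, η₂` smooth, divergence free, bounded and in `L² ∩ Ḣ¹`, `Re η = η₁ ≢ 0`,
satisfy `L_ss η = λη` classically, where
`−L_ss η = −½(1 + ξ·∇)η − Δη + P(Ū·∇η + η·∇Ū)` ((1.10); `negLss`, with the classical Leray
projection `P = classicalLerayProj`, `P[G] = G − ∇Δ⁻¹div G` for `G ∈ C_c^∞`) — in real and
imaginary parts: `aη₁ − bη₂ + (−L_ss)η₁ = 0`, `bη₁ + aη₂ + (−L_ss)η₂ = 0`. Then
`albritton_brue_colombo_unit` holds. This is exactly the datum of [ABC] Thm. 1.3 (a) ("the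
linearized operator `L_ss` … has a non-trivial unstable eigenvalue `λ`; the corresponding
non-trivial eigenfunction `η` belongs to `H^k` for all `k ≥ 0`: `L_ss η = λη`", with
`a = Re λ > 0`; `η ∈ ∩ₖH^k ⊂ C^∞ ∩ L^∞ ∩ L² ∩ Ḣ¹`, `η ∈ L²_σ` divergence free; `Re η ≢ 0` after
multiplying `η` by a unimodular constant). Proof: the pressures `qⱼ := −π[B(Ū, ηⱼ)]`,
`B(Ū, η) = Ū·∇η + η·∇Ū ∈ C_c^∞` (supported in `supp Ū`), are smooth and in `L²`
(`ClassicalLerayProjection`: Poisson equation and dipole decay of the Newtonian potential of a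
divergence), and `(−L_ss)η = N_Ū(η) + ∇q` (`negLss_eq_steadyLinearizedResidual_sub`), so
`albritton_brue_colombo_unit_of_unstableMode` applies. NOT proved here: the existence of
`(Ū, λ, η)` — [ABC] Thm. 1.3 (a) = Cor. 3.2 ∘ Thm. 3.1 ∘ Prop. 2.6 ∘ Cor. 2.3 ∘ Prop. 2.2 ∘
Thm. 2.1 (Vishik), the spectral core of the paper, and the regularity of the eigenfunction.
[cite: AlbrittonBrueColombo2022, Thm. 1.3 (a) (L_ss η = λη) with (1.10) ⟹ Thm. 1.2] -/
theorem albritton_brue_colombo_unit_of_eigenmode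
    {Ubar : EuclideanSpace ℝ (Fin 3) → EuclideanSpace ℝ (Fin 3)} (hUs : ContDiff ℝ ∞ Ubar)
    (hUc : HasCompactSupport Ubar) (hUdiv : VectorCalculus.IsDivFree Ubar) {a b : ℝ} (ha : 0 ≤ a)
    {η₁ η₂ : EuclideanSpace ℝ (Fin 3) → EuclideanSpace ℝ (Fin 3)}
    (hη₁ : ContDiff ℝ ∞ η₁) (hη₂ : ContDiff ℝ ∞ η₂)
    (hdiv₁ : VectorCalculus.IsDivFree η₁) (hdiv₂ : VectorCalculus.IsDivFree η₂)
    (heig₁ : ∀ ξ, a • η₁ ξ - b • η₂ ξ + negLss Ubar η₁ ξ = 0)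
    (heig₂ : ∀ ξ, b • η₁ ξ + a • η₂ ξ + negLss Ubar η₂ ξ = 0)
    {K : ℝ} (hK₁ : ∀ ξ, ‖η₁ ξ‖ ≤ K) (hK₂ : ∀ ξ, ‖η₂ ξ‖ ≤ K)
    (hI₁ : ∫⁻ ξ, ‖η₁ ξ‖ₑ ^ 2 < ⊤) (hI₂ : ∫⁻ ξ, ‖η₂ ξ‖ₑ ^ 2 < ⊤)
    (hJ₁ : ∫⁻ ξ, ENNReal.ofReal (frobeniusNormSq (fderiv ℝ η₁ ξ)) < ⊤)
    (hJ₂ : ∫⁻ ξ, ENNReal.ofReal (frobeniusNormSq (fderiv ℝ η₂ ξ)) < ⊤)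
    (hne : ∃ ξ₀, η₁ ξ₀ ≠ 0) :
    albritton_brue_colombo_unit := by
  -- the two compactly supported smooth fields `B(Ū, ηⱼ)` and their pressures
  have hB₁ : ContDiff ℝ ∞ (symConvect Ubar η₁) := contDiff_symConvect hUs hη₁
  have hB₂ : ContDiff ℝ ∞ (symConvect Ubar η₂) := contDiff_symConvect hUs hη₂
  have hB₁c : HasCompactSupport (symConvect Ubar η₁) := hasCompactSupport_symConvect hUc η₁
  have hB₂c : HasCompactSupport (symConvect Ubar η₂) := hasCompactSupport_symConvect hUc η₂
  have hq₁ : ContDiff ℝ ∞ fun ξ => -divPotential (symConvect Ubar η₁) ξ :=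
    (contDiff_divPotential hB₁ hB₁c).neg
  have hq₂ : ContDiff ℝ ∞ fun ξ => -divPotential (symConvect Ubar η₂) ξ :=
    (contDiff_divPotential hB₂ hB₂c).neg
  have hP₁ : ∫⁻ ξ, ‖-divPotential (symConvect Ubar η₁) ξ‖ₑ ^ 2 < ⊤ := by
    simp_rw [enorm_neg]
    exact lintegral_enorm_sq_divPotential_lt_top hB₁ hB₁c
  have hP₂ : ∫⁻ ξ, ‖-divPotential (symConvect Ubar η₂) ξ‖ₑ ^ 2 < ⊤ := by
    simp_rw [enorm_neg]
    exact lintegral_enorm_sq_divPotential_lt_top hB₂ hB₂c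
  refine albritton_brue_colombo_unit_of_unstableMode hUs hUc hUdiv (b := b) ha hη₁ hη₂ hq₁ hq₂ hdiv₁
    hdiv₂ (fun ξ => ?_) (fun ξ => ?_) hK₁ hK₂ hI₁ hI₂ hJ₁ hJ₂ hP₁ hP₂ hne
  · rw [gradient_fun_neg', ← sub_eq_add_neg, add_sub_assoc, ← negLss_eq_steadyLinearizedResidual_sub]
    exact heig₁ ξ
  · rw [gradient_fun_neg', ← sub_eq_add_neg, add_sub_assoc, ← negLss_eq_steadyLinearizedResidual_sub]
    exact heig₂ ξ

/-- **Albritton–Brué–Colombo 2022, Thm. 1.2 from a REAL eigenvalue `λ = a ≥ 0` of `L_ss`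
(verbatim (1.10))**: `Ū ∈ C_c^∞(ℝ³;ℝ³)` divergence free and a smooth bounded divergence-free
`η ∈ L² ∩ Ḣ¹`, `η ≢ 0`, with `aη + (−L_ss)η = 0` classically give `albritton_brue_colombo_unit`
(`albritton_brue_colombo_unit_of_eigenmode` with `b = 0`, `η₂ = 0`).
[cite: AlbrittonBrueColombo2022, Thm. 1.3 (a) with (1.10) ⟹ Thm. 1.2] -/
theorem albritton_brue_colombo_unit_of_realEigenmode
    {Ubar : EuclideanSpace ℝ (Fin 3) → EuclideanSpace ℝ (Fin 3)} (hUs : ContDiff ℝ ∞ Ubar)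
    (hUc : HasCompactSupport Ubar) (hUdiv : VectorCalculus.IsDivFree Ubar) {a : ℝ} (ha : 0 ≤ a)
    {η : EuclideanSpace ℝ (Fin 3) → EuclideanSpace ℝ (Fin 3)} (hη : ContDiff ℝ ∞ η)
    (hdiv : VectorCalculus.IsDivFree η) (heig : ∀ ξ, a • η ξ + negLss Ubar η ξ = 0)
    {K : ℝ} (hK : ∀ ξ, ‖η ξ‖ ≤ K) (hI : ∫⁻ ξ, ‖η ξ‖ₑ ^ 2 < ⊤)
    (hJ : ∫⁻ ξ, ENNReal.ofReal (frobeniusNormSq (fderiv ℝ η ξ)) < ⊤) (hne : ∃ ξ₀, η ξ₀ ≠ 0) :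
    albritton_brue_colombo_unit := by
  have hK0 : 0 ≤ K := (norm_nonneg _).trans (hK 0)
  -- `−L_ss 0 = 0`
  have hB0 : symConvect Ubar (fun _ => (0 : EuclideanSpace ℝ (Fin 3))) = 0 := by
    funext ξ
    have hD : fderiv ℝ (fun _ : EuclideanSpace ℝ (Fin 3) => (0 : EuclideanSpace ℝ (Fin 3))) ξ = 0 := by
      rw [show (fun _ : EuclideanSpace ℝ (Fin 3) => (0 : EuclideanSpace ℝ (Fin 3))) =
        (0 : EuclideanSpace ℝ (Fin 3) → EuclideanSpace ℝ (Fin 3)) from rfl, fderiv_zero]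
      rfl
    simp [symConvect, convect, hD]
  have hdiv00 : VectorCalculus.divergence (0 : EuclideanSpace ℝ (Fin 3) → EuclideanSpace ℝ (Fin 3)) =
      0 := by
    funext ξ
    rw [VectorCalculus.divergence, fderiv_zero]
    simp
  have hL0 : ∀ ξ, negLss Ubar (fun _ => (0 : EuclideanSpace ℝ (Fin 3))) ξ = 0 := fun ξ => by
    rw [negLss_eq_steadyLinearizedResidual_sub, steadyLinearizedResidual_zero, hB0, zero_sub,
      neg_eq_zero]
    have hπ : divPotential (0 : EuclideanSpace ℝ (Fin 3) → EuclideanSpace ℝ (Fin 3)) = fun _ => 0 := by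
      funext x
      rw [divPotential_apply, hdiv00]
      simp
    rw [hπ]
    rw [show (fun _ : EuclideanSpace ℝ (Fin 3) => (0 : ℝ)) = (0 : EuclideanSpace ℝ (Fin 3) → ℝ)
      from rfl, gradient, fderiv_zero]
    simp
  have hdiv0 : VectorCalculus.IsDivFree (fun _ : EuclideanSpace ℝ (Fin 3) =>
      (0 : EuclideanSpace ℝ (Fin 3))) := fun ξ => by
    rw [show (fun _ : EuclideanSpace ℝ (Fin 3) => (0 : EuclideanSpace ℝ (Fin 3))) =
      (0 : EuclideanSpace ℝ (Fin 3) → EuclideanSpace ℝ (Fin 3)) from rfl]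
    exact congr_fun hdiv00 ξ
  refine albritton_brue_colombo_unit_of_eigenmode hUs hUc hUdiv (b := 0) ha (η₂ := fun _ => 0) hη
    contDiff_const hdiv hdiv0 (fun ξ => ?_) (fun ξ => ?_) hK (fun ξ => by simpa using hK0) hI
    (by simp) hJ ?_ hne
  · rw [zero_smul, sub_zero]
    exact heig ξ
  · rw [zero_smul, smul_zero, zero_add, zero_add, hL0]
  · simp [frobeniusNormSq_zero]

/-- **ns.S20 (`albritton_brue_colombo`, every viscosity) from an eigenmode `L_ss η = λη` of the
operator (1.10) verbatim**, by `albritton_brue_colombo_unit_of_eigenmode` and the viscosity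
scaling `albritton_brue_colombo_of_unit`. [cite: AlbrittonBrueColombo2022, Thm. 1.3 (a) ⟹ Thm. 1.2] -/
theorem albritton_brue_colombo_of_eigenmode
    {Ubar : EuclideanSpace ℝ (Fin 3) → EuclideanSpace ℝ (Fin 3)} (hUs : ContDiff ℝ ∞ Ubar)
    (hUc : HasCompactSupport Ubar) (hUdiv : VectorCalculus.IsDivFree Ubar) {a b : ℝ} (ha : 0 ≤ a)
    {η₁ η₂ : EuclideanSpace ℝ (Fin 3) → EuclideanSpace ℝ (Fin 3)}
    (hη₁ : ContDiff ℝ ∞ η₁) (hη₂ : ContDiff ℝ ∞ η₂)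
    (hdiv₁ : VectorCalculus.IsDivFree η₁) (hdiv₂ : VectorCalculus.IsDivFree η₂)
    (heig₁ : ∀ ξ, a • η₁ ξ - b • η₂ ξ + negLss Ubar η₁ ξ = 0)
    (heig₂ : ∀ ξ, b • η₁ ξ + a • η₂ ξ + negLss Ubar η₂ ξ = 0)
    {K : ℝ} (hK₁ : ∀ ξ, ‖η₁ ξ‖ ≤ K) (hK₂ : ∀ ξ, ‖η₂ ξ‖ ≤ K)
    (hI₁ : ∫⁻ ξ, ‖η₁ ξ‖ₑ ^ 2 < ⊤) (hI₂ : ∫⁻ ξ, ‖η₂ ξ‖ₑ ^ 2 < ⊤)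
    (hJ₁ : ∫⁻ ξ, ENNReal.ofReal (frobeniusNormSq (fderiv ℝ η₁ ξ)) < ⊤)
    (hJ₂ : ∫⁻ ξ, ENNReal.ofReal (frobeniusNormSq (fderiv ℝ η₂ ξ)) < ⊤)
    (hne : ∃ ξ₀, η₁ ξ₀ ≠ 0) :
    albritton_brue_colombo :=
  albritton_brue_colombo_of_unit
    (albritton_brue_colombo_unit_of_eigenmode hUs hUc hUdiv ha hη₁ hη₂ hdiv₁ hdiv₂ heig₁ heig₂ hK₁
      hK₂ hI₁ hI₂ hJ₁ hJ₂ hne)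

end Eigenmode

end Literature.Analysis.FluidPDE

end
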